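import Literature.Barriers.Parity.SiegelZeroDichotomyChowlaTools
import HarnessLib

/-!
# Step (i) of Tao–Teräväinen at `k = 0`: Proposition 4.2 from Corollary 3.6
# (`TaoTeravainen2021_prop42_k0` reduced to Proposition 3.5)

Topic `Literature/Barriers/Parity`; fourth file of the proof DAG of
`Literature.Barriers.Parity.TaoTeravainen2021_chowla` (`SiegelZeroDichotomyChowla.lean`). PROVED here:

* `TaoTeravainen2021_prop42_k0_of_cor36` — the named fact `TaoTeravainen2021_prop42_k0`
  (Proposition 4.2 at `k = 0`: `|𝔼_{n ≤ x} ∏ⱼ λ(n+h'ⱼ) - 𝔼_{n ≤ x} ∏ⱼ λ_Siegel(n+h'ⱼ)| ≤ C/log^{1/10} η`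
  on `q_χ^{1/2+ε₀} ≤ x ≤ q_χ^{η^{1/2}}`) follows from Corollary 3.6 (first bound,
  `Literature.NumberTheory.LFunctions.SiegelZero.TaoTeravainen2021_cor36_i`);
* `TaoTeravainen2021_prop42_k0_of_prop35` — hence from Proposition 3.5 ((3.13), (3.14):
  `TaoTeravainen2021_eq313`, `TaoTeravainen2021_eq314`), by `TaoTeravainen2021_cor36_i_of_prop35`.

The argument is §4 of the source at `k = 0` ("From (4.2) and the triangle inequality, it suffices
to show that `𝔼_{n ≤ x} |λ(n+h'_{j'}) - λ_Siegel(n+h'_{j'})| ≈ 0` for each `1 ≤ j' ≤ ℓ`. Applying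
Lemma 4.1, it suffices to show the bounds (4.4) and (4.5)"), with the counting of
`SiegelZeroDichotomyChowlaModel.lean` and the tools of `SiegelZeroDichotomyChowlaTools.lean`:
per shift `h` (`card_filter_ne_le_mul`),
`#{n ≤ x : λ(n+h) ≠ λ_Siegel(n+h)} ≤ x ∑_{R₀ ≤ p* ≤ x} 1/p* + x/R + ∑_{d ≤ 2R} π(2x/d)
≤ x (E + 1/R + 12 C₀ log_x R)` ((4.4) by Corollary 3.6 since `R ≥ R₀`, (4.5) by Chebyshev); summing
over the shifts (`abs_avg_sub_avg_le`) and taking `R = x^{1/log^{1/5} η}`, `log x ≥ ¼ log η`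
(Siegel, (1.4)), each term is `O(log^{-1/10} η)`.
[cite: TaoTeravainen2021, §4 (proof of Proposition 4.2), Corollary 3.6, (2.3), (2.8), (2.10)]
-/

noncomputable section

open Finset Real
open scoped Nat.Prime
open Literature.NumberTheory.LFunctions.SiegelZero (excPrimes mem_excPrimes TaoTeravainen2021_cor36_i
  TaoTeravainen2021_eq313 TaoTeravainen2021_eq314 TaoTeravainen2021_cor36_i_of_prop35)

namespace Literature.Barriers.Parity

namespace TaoTeravainen

/-- `∑_{n ≤ x} |λ(n+h) - λ_Siegel(n+h)| ≤ 2 #{n ≤ x : λ(n+h) ≠ λ_Siegel(n+h)}` ((4.2)). [cite: TaoTeravainen2021, §4 (4.2)] -/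
theorem sum_abs_sub_le_two_mul_card {q : ℕ} (χ : DirichletCharacter ℂ q) (R : ℝ) (x h : ℕ) :
    ∑ n ∈ Icc 1 x, |(ArithmeticFunction.liouville (n + h) : ℝ) - liouvilleSiegel χ R (n + h)| ≤
      2 * #((Icc 1 x).filter fun n =>
        (ArithmeticFunction.liouville (n + h) : ℝ) ≠ liouvilleSiegel χ R (n + h)) := by
  classical
  have hpt : ∀ n ∈ Icc 1 x,
      |(ArithmeticFunction.liouville (n + h) : ℝ) - liouvilleSiegel χ R (n + h)| ≤
        if (ArithmeticFunction.liouville (n + h) : ℝ) ≠ liouvilleSiegel χ R (n + h) then (2 : ℝ)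
        else 0 := by
    intro n _
    split_ifs with hne
    · exact abs_liouville_sub_liouvilleSiegel_le_two χ R (n + h)
    · rw [not_ne_iff.mp hne, sub_self, abs_zero]
  refine (sum_le_sum hpt).trans (le_of_eq ?_)
  rw [Finset.sum_ite, Finset.sum_const_zero, add_zero, Finset.sum_const, nsmul_eq_mul, mul_comm]

/-- **Summing over the shifts** ("From (4.2) and the triangle inequality, it suffices to show that
`𝔼_{n ≤ x} |λ(n+h'_{j'}) - λ_Siegel(n+h'_{j'})| ≈ 0` for each `j'`"): if for every shift `h ∈ H`
the integers `n ≤ x` with `λ(n+h) ≠ λ_Siegel(n+h)` number at most `x B`, then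
`|𝔼_{n ≤ x} ∏_{h ∈ H} λ(n+h) - 𝔼_{n ≤ x} ∏_{h ∈ H} λ_Siegel(n+h)| ≤ 2 #H · B`.
[cite: TaoTeravainen2021, §4 (reduction of Proposition 4.2 to (4.4), (4.5))] -/
theorem abs_avg_sub_avg_le {q : ℕ} (χ : DirichletCharacter ℂ q) (R : ℝ) (H : Finset ℕ) {x : ℕ}
    (hx : 0 < x) {B : ℝ}
    (hcount : ∀ h ∈ H, (#((Icc 1 x).filter fun n =>
      (ArithmeticFunction.liouville (n + h) : ℝ) ≠ liouvilleSiegel χ R (n + h)) : ℝ) ≤ x * B) :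
    |liouvilleTupleAverage H x - tupleAverage (liouvilleSiegel χ R) H x| ≤ 2 * #H * B := by
  have hx0 : (0 : ℝ) < x := by exact_mod_cast hx
  simp only [liouvilleTupleAverage, tupleAverage]
  rw [← sub_div, ← sum_sub_distrib, abs_div, abs_of_pos hx0, div_le_iff₀ hx0]
  calc |∑ n ∈ Icc 1 x, (∏ h ∈ H, (ArithmeticFunction.liouville (n + h) : ℝ) -
          ∏ h ∈ H, liouvilleSiegel χ R (n + h))|
      ≤ ∑ n ∈ Icc 1 x, |∏ h ∈ H, (ArithmeticFunction.liouville (n + h) : ℝ) -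
          ∏ h ∈ H, liouvilleSiegel χ R (n + h)| := abs_sum_le_sum_abs _ _
    _ ≤ ∑ n ∈ Icc 1 x, ∑ h ∈ H,
          |(ArithmeticFunction.liouville (n + h) : ℝ) - liouvilleSiegel χ R (n + h)| :=
        sum_le_sum fun n _ => abs_prod_sub_prod_le H
          (fun h _ => Literature.NumberTheory.Sieve.abs_liouville_le_one _)
          (fun h _ => abs_liouvilleSiegel_le_one χ R _)
    _ = ∑ h ∈ H, ∑ n ∈ Icc 1 x,
          |(ArithmeticFunction.liouville (n + h) : ℝ) - liouvilleSiegel χ R (n + h)| := sum_comm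
    _ ≤ ∑ h ∈ H, 2 * (x * B) := by
        refine sum_le_sum fun h hh => (sum_abs_sub_le_two_mul_card χ R x h).trans ?_
        exact mul_le_mul_of_nonneg_left (hcount h hh) zero_le_two
    _ = 2 * #H * B * x := by rw [sum_const, nsmul_eq_mul]; ring

/-- **The per-shift count, (4.4) + (4.5) at `k = 0`**: for `e ≤ R`, `R² ≤ x`, `R₀ ≤ R`, a shift
`h ≤ x`, and a bound `∑_{R₀ ≤ p* ≤ x} 1/p* ≤ E` on the exceptional primes,
`#{n ≤ x : λ(n+h) ≠ λ_Siegel(n+h)} ≤ x (E + 1/R + 12 C₀ log R/log x)`, `C₀ = 2 log 4 + 2`.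
[cite: TaoTeravainen2021, §4 ((4.4), (4.5))] -/
theorem card_filter_ne_le_mul {q : ℕ} (χ : DirichletCharacter ℂ q) {x h : ℕ} {R R₀ E : ℝ}
    (hRe : Real.exp 1 ≤ R) (hRx : R ^ 2 ≤ x) (hR₀R : R₀ ≤ R) (hhx : h ≤ x)
    (hexc : ∑ p ∈ excPrimes χ (Icc ⌈R₀⌉₊ ⌊(x : ℝ)⌋₊), (1 : ℝ) / p ≤ E) :
    (#((Icc 1 x).filter fun n =>
      (ArithmeticFunction.liouville (n + h) : ℝ) ≠ liouvilleSiegel χ R (n + h)) : ℝ) ≤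
      x * (E + 1 / R + 12 * (2 * Real.log 4 + 2) * Real.log R / Real.log x) := by
  have hR1 : 1 ≤ R := le_trans (by linarith [Real.add_one_le_exp (1 : ℝ)]) hRe
  have hR0 : 0 < R := by linarith
  have hx0 : (0 : ℝ) ≤ x := Nat.cast_nonneg _
  refine (card_filter_ne_le χ hR1 x h hhx).trans ?_
  -- (4.4): the exceptional primes `R < p* ≤ x/R`
  set P₁ := excPrimes χ (Ioc ⌊R⌋₊ ⌊(x : ℝ) / R⌋₊) with hP₁
  have hP₁sub : P₁ ⊆ excPrimes χ (Icc ⌈R₀⌉₊ ⌊(x : ℝ)⌋₊) := by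
    intro p hp
    rw [hP₁, mem_excPrimes, mem_Ioc] at hp
    rw [mem_excPrimes, mem_Icc, Nat.floor_natCast]
    refine ⟨⟨Nat.ceil_le.mpr ?_, ?_⟩, hp.2⟩
    · have : R < p := (Nat.floor_lt hR0.le).mp hp.1.1
      linarith
    · have h1 : (p : ℝ) ≤ (x : ℝ) / R := (Nat.le_floor_iff (by positivity)).mp hp.1.2
      have h2 : (x : ℝ) / R ≤ x := div_le_self hx0 hR1
      exact_mod_cast h1.trans h2
  have hsum1 : ∑ p ∈ P₁, (1 : ℝ) / p ≤ E :=
    (sum_le_sum_of_subset_of_nonneg hP₁sub fun p _ _ => by positivity).trans hexc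
  have hcard1 : (#P₁ : ℝ) ≤ x / R := by
    have h1 : #P₁ ≤ #(Ioc ⌊R⌋₊ ⌊(x : ℝ) / R⌋₊) := card_le_card (filter_subset _ _)
    rw [Nat.card_Ioc] at h1
    have h2 : (#P₁ : ℝ) ≤ ⌊(x : ℝ) / R⌋₊ := by exact_mod_cast h1.trans (Nat.sub_le _ _)
    exact h2.trans (Nat.floor_le (by positivity))
  have hfirst : ∑ p ∈ P₁, ((x : ℝ) / p + 1) ≤ x * E + x / R := by
    rw [sum_add_distrib, sum_const, nsmul_eq_mul, mul_one]
    refine add_le_add ?_ hcard1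
    rw [show ∑ p ∈ P₁, (x : ℝ) / p = x * ∑ p ∈ P₁, (1 : ℝ) / p by
      rw [mul_sum]; refine sum_congr rfl fun p _ => ?_; ring]
    exact mul_le_mul_of_nonneg_left hsum1 hx0
  -- (4.5): the smooth part
  have hsecond := sum_primeCounting_div_le hRe hRx hhx
  calc _ ≤ x * E + x / R + 12 * (2 * Real.log 4 + 2) * x * Real.log R / Real.log x :=
        add_le_add hfirst hsecond
    _ = x * (E + 1 / R + 12 * (2 * Real.log 4 + 2) * Real.log R / Real.log x) := by ring

/-- **The scales at `k = 0`.** With `L = log η ≥ 1024`, `t = L^{1/5}` and `log x ≥ L/4`, the scale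
`R = x^{1/t}` ((2.3)) satisfies `e ≤ R`, `R² ≤ x`, `R₀ = x^{1/√L} ≤ R` ((2.5)), `√t ≤ R`, and
`log R/log x = 1/t`; moreover `4 ≤ t ≤ L` and `√t = L^{1/10}`. [cite: TaoTeravainen2021, §2.4 ((2.3), (2.5), (2.8))] -/
theorem scales_k0 {L x : ℝ} (hL : 1024 ≤ L) (hx1 : 1 < x) (hlogx : L / 4 ≤ Real.log x) :
    4 ≤ L ^ ((1 : ℝ) / 5) ∧ L ^ ((1 : ℝ) / 5) ≤ L ∧
      Real.sqrt (L ^ ((1 : ℝ) / 5)) = L ^ ((1 : ℝ) / 10) ∧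
      Real.exp 1 ≤ x ^ (1 / L ^ ((1 : ℝ) / 5)) ∧ (x ^ (1 / L ^ ((1 : ℝ) / 5))) ^ 2 ≤ x ∧
      x ^ (1 / Real.sqrt L) ≤ x ^ (1 / L ^ ((1 : ℝ) / 5)) ∧
      Real.sqrt (L ^ ((1 : ℝ) / 5)) ≤ x ^ (1 / L ^ ((1 : ℝ) / 5)) ∧
      Real.log (x ^ (1 / L ^ ((1 : ℝ) / 5))) / Real.log x = 1 / L ^ ((1 : ℝ) / 5) := by
  set t : ℝ := L ^ ((1 : ℝ) / 5) with ht
  set R : ℝ := x ^ (1 / t) with hR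
  have hL0 : 0 < L := by linarith
  have hx0 : 0 < x := by linarith
  have hlogx0 : 0 < Real.log x := Real.log_pos hx1
  have ht4 : 4 ≤ t := by
    have h4 : (4 : ℝ) = (1024 : ℝ) ^ ((1 : ℝ) / 5) := by
      rw [show (1024 : ℝ) = 4 ^ (5 : ℕ) by norm_num, show (1 : ℝ) / 5 = ((5 : ℕ) : ℝ)⁻¹ by norm_num,
        Real.pow_rpow_inv_natCast (by norm_num) (by norm_num)]
    rw [h4, ht]
    exact Real.rpow_le_rpow (by norm_num) hL (by norm_num)
  have ht0 : 0 < t := by linarith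
  have ht1 : 1 ≤ t := by linarith
  have ht5 : t ^ (5 : ℕ) = L := by
    rw [← Real.rpow_natCast, ht, ← Real.rpow_mul hL0.le]
    norm_num
  have htL : t ≤ L := by
    calc t = t ^ (1 : ℕ) := (pow_one t).symm
      _ ≤ t ^ (5 : ℕ) := pow_le_pow_right₀ ht1 (by norm_num)
      _ = L := ht5
  have hsqt : Real.sqrt t = L ^ ((1 : ℝ) / 10) := by
    rw [Real.sqrt_eq_rpow, ht, ← Real.rpow_mul hL0.le]
    norm_num
  have hsqt0 : 0 < Real.sqrt t := Real.sqrt_pos.mpr ht0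
  have hR1 : 1 ≤ R := Real.one_le_rpow hx1.le (by positivity)
  have hR0 : 0 < R := by linarith
  have hlogR : Real.log R = Real.log x / t := by
    rw [hR, Real.log_rpow hx0]; ring
  have hlogR_ge : t ^ 4 / 4 ≤ Real.log R := by
    rw [hlogR, le_div_iff₀ ht0]
    calc t ^ 4 / 4 * t = t ^ (5 : ℕ) / 4 := by ring
      _ = L / 4 := by rw [ht5]
      _ ≤ Real.log x := hlogx
  have ht3 : (64 : ℝ) ≤ t ^ 3 := le_trans (by norm_num) (pow_le_pow_left₀ (by norm_num) ht4 3)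
  have h16 : 16 * t ≤ t ^ 4 / 4 := by nlinarith [ht3, ht0]
  have hRe : Real.exp 1 ≤ R := by
    rw [← Real.exp_log hR0]; exact Real.exp_le_exp.mpr (by linarith)
  have hsqt_R : Real.sqrt t ≤ R := by
    rw [← Real.log_le_log_iff hsqt0 hR0, Real.log_sqrt ht0.le]
    have h1 := Real.log_le_sub_one_of_pos ht0
    linarith
  have hRx : R ^ 2 ≤ x := by
    have h1 : R ^ 2 = x ^ (2 / t) := by
      rw [← Real.rpow_natCast, hR, ← Real.rpow_mul hx0.le]
      congr 1
      push_cast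
      ring
    rw [h1]
    calc x ^ (2 / t) ≤ x ^ (1 : ℝ) :=
        Real.rpow_le_rpow_of_exponent_le hx1.le (by rw [div_le_one ht0]; linarith)
      _ = x := Real.rpow_one _
  have hR₀R : x ^ (1 / Real.sqrt L) ≤ R := by
    refine Real.rpow_le_rpow_of_exponent_le hx1.le ?_
    have htsq : t ≤ Real.sqrt L := by
      rw [Real.le_sqrt' ht0]
      calc t ^ 2 ≤ t ^ (5 : ℕ) := pow_le_pow_right₀ ht1 (by norm_num)
        _ = L := ht5
    exact div_le_div_of_nonneg_left zero_le_one ht0 htsq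
  have hratio : Real.log R / Real.log x = 1 / t := by
    rw [hlogR]; field_simp
  exact ⟨ht4, htL, hsqt, hRe, hRx, hR₀R, hsqt_R, hratio⟩

end TaoTeravainen

open TaoTeravainen

/-- **Proposition 4.2 at `k = 0` from Corollary 3.6 (first bound).**
[cite: TaoTeravainen2021, §4 (proof of Proposition 4.2) and Corollary 3.6] -/
theorem TaoTeravainen2021_prop42_k0_of_cor36 (h36 : TaoTeravainen2021_cor36_i) :
    TaoTeravainen2021_prop42_k0 := by
  intro H hH hH1
  refine ⟨1 / 4, by norm_num, fun ε₀ hε₀ _ => ?_⟩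
  obtain ⟨K, η₀, hK⟩ := h36 (2 * ε₀) (by linarith)
  obtain ⟨c, hc⟩ := exists_log_le_log_conductor_add
  set K' : ℝ := max K 0 with hK'
  have hK'0 : 0 ≤ K' := le_max_right _ _
  set C₀ : ℝ := 2 * Real.log 4 + 2 with hC₀
  have hC₀0 : 0 < C₀ := by have := Real.log_pos (by norm_num : (1 : ℝ) < 4); positivity
  set hmax : ℕ := H.max' hH with hhmax
  set Lmin : ℝ := max (max 1024 (2 * |c| + 2)) (4 * Real.log ((hmax : ℝ) + 16)) with hLmin
  refine ⟨2 * (#H : ℝ) * (2 * K' + 1 + 12 * C₀), max η₀ (Real.exp Lmin), ?_⟩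
  intro q _ χ η hS hη x hlo hhi
  /- thresholds -/
  have hη₀ : η₀ ≤ η := (le_max_left _ _).trans hη
  have hη0 : 0 < η := by linarith [hS.ten_le]
  set L : ℝ := Real.log η with hLdef
  have hLmin_le : Lmin ≤ L := by
    rw [hLdef, ← Real.log_exp Lmin]
    exact Real.log_le_log (Real.exp_pos _) ((le_max_right _ _).trans hη)
  have hL1024 : (1024 : ℝ) ≤ L := ((le_max_left _ _).trans (le_max_left _ _)).trans hLmin_le
  have hLc : 2 * |c| + 2 ≤ L := ((le_max_right _ _).trans (le_max_left _ _)).trans hLmin_le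
  have hLh : 4 * Real.log ((hmax : ℝ) + 16) ≤ L := (le_max_right _ _).trans hLmin_le
  have hL0 : 0 < L := by linarith
  /- the conductor and `x` are large (Siegel) -/
  have hq1 : (1 : ℝ) < q := by exact_mod_cast (lt_of_lt_of_le (by norm_num) hS.three_le : 1 < q)
  have hq0 : (0 : ℝ) < q := by linarith
  have hlogq : L / 2 + 1 ≤ Real.log q := by
    have := hc q χ η hS
    have habs := le_abs_self c
    linarith
  have hxlo1 : (1 : ℝ) < (q : ℝ) ^ ((1 : ℝ) / 2 + ε₀) := Real.one_lt_rpow hq1 (by linarith)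
  have hx1 : (1 : ℝ) < x := hxlo1.trans_le hlo
  have hx0 : (0 : ℝ) < x := by linarith
  have hxℕ : 0 < x := by exact_mod_cast (show (0 : ℝ) < x from hx0)
  have hlogx : L / 4 ≤ Real.log x := by
    have h1 : Real.log ((q : ℝ) ^ ((1 : ℝ) / 2 + ε₀)) ≤ Real.log x :=
      Real.log_le_log (by positivity) hlo
    rw [Real.log_rpow hq0] at h1
    have h2 : (1 / 2 : ℝ) * Real.log q ≤ ((1 : ℝ) / 2 + ε₀) * Real.log q :=
      mul_le_mul_of_nonneg_right (by linarith) (by linarith)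
    linarith
  have hxh : (hmax : ℝ) + 16 ≤ x := by
    have h1 : Real.log ((hmax : ℝ) + 16) ≤ Real.log x := by linarith
    exact (Real.log_le_log_iff (by positivity) hx0).mp h1
  have hhmax_x : hmax ≤ x := by exact_mod_cast (show (hmax : ℝ) ≤ x by linarith)
  /- the scales -/
  obtain ⟨ht4, htL, hsqt, hRe, hRx, hR₀R, hsqt_R, hratio⟩ := scales_k0 hL1024 hx1 hlogx
  set t : ℝ := L ^ ((1 : ℝ) / 5) with ht
  set R : ℝ := (x : ℝ) ^ (1 / t) with hRdef
  have ht0 : 0 < t := by linarith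
  have hsqt0 : 0 < Real.sqrt t := Real.sqrt_pos.mpr ht0
  have hR0 : 0 < R := lt_of_lt_of_le (Real.exp_pos 1) hRe
  have hscaleR : scaleR η x = R := by rw [scaleR, hRdef, ht, hLdef]
  /- Corollary 3.6 and the per-shift count -/
  have hexc : ∑ p ∈ excPrimes χ (Icc ⌈(x : ℝ) ^ (1 / Real.sqrt L)⌉₊ ⌊(x : ℝ)⌋₊), (1 : ℝ) / p ≤
      K' * Real.exp (-Real.sqrt L / 2) := by
    have hlo' : (q : ℝ) ^ ((1 + 2 * ε₀) / 2) ≤ x := by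
      rw [show (1 + 2 * ε₀) / 2 = (1 : ℝ) / 2 + ε₀ by ring]; exact hlo
    have h := hK q χ hS.1 hS.2.1 η hη₀ hS.2.2.2 x hlo' hhi
    exact h.trans (mul_le_mul_of_nonneg_right (le_max_left _ _) (Real.exp_pos _).le)
  set B : ℝ := K' * Real.exp (-Real.sqrt L / 2) + 1 / R + 12 * C₀ * Real.log R / Real.log x
    with hB
  have hcount : ∀ h ∈ H, (#((Icc 1 x).filter fun n =>
      (ArithmeticFunction.liouville (n + h) : ℝ) ≠ liouvilleSiegel χ R (n + h)) : ℝ) ≤ x * B :=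
    fun h hh => card_filter_ne_le_mul χ hRe hRx hR₀R ((H.le_max' h hh).trans hhmax_x) hexc
  have hdiff := abs_avg_sub_avg_le χ R H hxℕ hcount
  /- each term of `B` is `O(1/√t) = O(log^{-1/10} η)` -/
  have hB_le : B ≤ (2 * K' + 1 + 12 * C₀) / Real.sqrt t := by
    have h1 : Real.exp (-Real.sqrt L / 2) ≤ 2 / Real.sqrt t := by
      have he : Real.sqrt L / 2 ≤ Real.exp (Real.sqrt L / 2) := by
        linarith [Real.add_one_le_exp (Real.sqrt L / 2)]
      have hst : Real.sqrt t ≤ Real.sqrt L := Real.sqrt_le_sqrt htL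
      rw [show -Real.sqrt L / 2 = -(Real.sqrt L / 2) by ring, Real.exp_neg, inv_eq_one_div,
        div_le_div_iff₀ (Real.exp_pos _) hsqt0, one_mul]
      exact hst.trans (by linarith only [he])
    have h2 : 1 / R ≤ 1 / Real.sqrt t := div_le_div_of_nonneg_left zero_le_one hsqt0 hsqt_R
    have h3 : 12 * C₀ * Real.log R / Real.log x ≤ 12 * C₀ / Real.sqrt t := by
      rw [mul_div_assoc, hratio, div_eq_mul_one_div (12 * C₀) (Real.sqrt t)]
      refine mul_le_mul_of_nonneg_left (div_le_div_of_nonneg_left zero_le_one hsqt0 ?_)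
        (by positivity)
      have htt : t ≤ t ^ 2 := by nlinarith only [ht4]
      calc Real.sqrt t ≤ Real.sqrt (t ^ 2) := Real.sqrt_le_sqrt htt
        _ = t := Real.sqrt_sq ht0.le
    calc B = _ := hB
      _ ≤ K' * (2 / Real.sqrt t) + 1 / Real.sqrt t + 12 * C₀ / Real.sqrt t :=
          add_le_add (add_le_add (mul_le_mul_of_nonneg_left h1 hK'0) h2) h3
      _ = (2 * K' + 1 + 12 * C₀) / Real.sqrt t := by field_simp
  calc |liouvilleTupleAverage H x - tupleAverage (liouvilleSiegel χ (scaleR η x)) H x|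
      ≤ 2 * #H * B := by rw [hscaleR]; exact hdiff
    _ ≤ 2 * #H * ((2 * K' + 1 + 12 * C₀) / Real.sqrt t) :=
        mul_le_mul_of_nonneg_left hB_le (by positivity)
    _ = 2 * (#H : ℝ) * (2 * K' + 1 + 12 * C₀) / Real.log η ^ ((1 : ℝ) / 10) := by
        rw [hsqt, hLdef]; ring

/-- **Proposition 4.2 at `k = 0` from Proposition 3.5** ((3.13), (3.14)), through Corollary 3.6.
[cite: TaoTeravainen2021, Proposition 4.2, Corollary 3.6, Proposition 3.5] -/
theorem TaoTeravainen2021_prop42_k0_of_prop35 (h₁ : TaoTeravainen2021_eq313)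
    (h₂ : TaoTeravainen2021_eq314) : TaoTeravainen2021_prop42_k0 :=
  TaoTeravainen2021_prop42_k0_of_cor36 (TaoTeravainen2021_cor36_i_of_prop35 h₁ h₂)

end Literature.Barriers.Parity
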